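import Summits.CriticalPhenomena.CardyFormulaZ2.Theorems.CardyUniqueLimitCardyRigidityKernelODETaylor

/-!
# Viscosity inequalities from asymptotic mean-value identities (line `crossing-martingale`, crux `CardyRigidity`)

Pure-analysis back-end of stub `stub_kernelAffineCardy` of crux `CardyRigidity`
(stmt-CriticalPhenomena-0746), line `crossing_martingale`.  Let `f` be continuous near `η` and
satisfy, for large `n`, the EXACT mean-value identities `∫ f (η + x) dνₙ(x) = f η` for probability
measures `νₙ` carried by `[-rₙ, rₙ]`, `rₙ → 0`, whose first two moments have the asymptotics
`ρₙ ∫ x dνₙ → L₁`, `ρₙ ∫ x² dνₙ → L₂` along some positive scale `ρₙ` (e.g. `ρₙ = n` or `n²`).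
THEN `f` satisfies the viscosity inequalities of the operator `(L₂/2) u'' + L₁ u'` at `η`:

* `touchingAbove_of_mvp` — if a smooth `φ` touches `f` from above at `η` then
  `0 ≤ (L₂/2) φ''(η) + L₁ φ'(η)`;
* `touchingBelow_of_mvp` — if `φ` touches from below then `(L₂/2) φ''(η) + L₁ φ'(η) ≤ 0`.

(Proof: `f η = ∫ f(η+x) dνₙ ≤ ∫ φ(η+x) dνₙ = φ η + φ'(η) m₁ + ½ φ''(η) m₂ + o(m₂)` by the
second-order Taylor estimate `KernelODE.abs_integral_shift_sub_le`; multiply by `ρₙ` and pass to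
the limit.)  These feed `Literature.Analysis.ODE.eq_of_touching` (first order: constancy) and
`Literature.Analysis.ODE.contDiffOn_and_ode_of_touching` (second order: classical solutions).
-/

noncomputable section

open MeasureTheory Filter Set Topology
open scoped ContDiff

namespace Summit.CriticalPhenomena.CardyFormulaZ2.Cruxes.CardyRigidity.CrossingMartingale

namespace KernelODE

/-- A uniform continuity modulus of a continuous function at a point, on a symmetric interval.
[folklore] -/
theorem exists_modulus_of_continuous {g : ℝ → ℝ} (hg : Continuous g) (η : ℝ) {ε : ℝ} (hε : 0 < ε) :
    ∃ ρ₀ : ℝ, 0 < ρ₀ ∧ ∀ x ∈ Icc (-ρ₀) ρ₀, |g (η + x) - g η| ≤ ε := by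
  have hc : ContinuousAt (fun x ↦ g (η + x)) 0 := (hg.comp (continuous_const_add η)).continuousAt
  obtain ⟨δ', hδ', hball⟩ := Metric.continuousAt_iff.1 hc ε hε
  refine ⟨δ' / 2, by positivity, fun x hx ↦ ?_⟩
  have hx' : dist x 0 < δ' := by
    rw [Real.dist_eq, sub_zero]
    exact (abs_le.2 ⟨hx.1, hx.2⟩).trans_lt (by linarith)
  have := hball hx'
  simp only [add_zero, Real.dist_eq] at this
  exact this.le

/-- **Touching from above.**  See the module docstring. [folklore] -/
theorem touchingAbove_of_mvp {f φ : ℝ → ℝ} {η δ : ℝ} (hδ : 0 < δ)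
    (hf : ContinuousOn f (Icc (η - δ) (η + δ))) (hφ : ContDiff ℝ ∞ φ)
    (hφη : φ η = f η) (hle : ∀ᶠ y in 𝓝 η, f y ≤ φ y)
    {ν : ℕ → Measure ℝ} (hprob : ∀ n, IsProbabilityMeasure (ν n))
    {r ρ : ℕ → ℝ} {L₁ L₂ : ℝ}
    (hr : Tendsto r atTop (𝓝 0)) (hsupp : ∀ᶠ n in atTop, (ν n) (Icc (-(r n)) (r n))ᶜ = 0)
    (hmvp : ∀ᶠ n in atTop, ∫ x, f (η + x) ∂(ν n) = f η)
    (hρ : ∀ᶠ n in atTop, 0 < ρ n)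
    (h₁ : Tendsto (fun n ↦ ρ n * ∫ x, x ∂(ν n)) atTop (𝓝 L₁))
    (h₂ : Tendsto (fun n ↦ ρ n * ∫ x, x ^ 2 ∂(ν n)) atTop (𝓝 L₂)) :
    0 ≤ L₂ / 2 * deriv (deriv φ) η + L₁ * deriv φ η := by
  -- derivatives of `φ`
  have hd1 : ContDiff ℝ ∞ (deriv φ) := by simpa using hφ.iterate_deriv 1
  have hd2 : ContDiff ℝ ∞ (deriv (deriv φ)) := by simpa using hd1.iterate_deriv 1
  have hφ' : ∀ y, HasDerivAt φ (deriv φ y) y := fun y ↦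
    (hφ.differentiable (by simp) y).hasDerivAt
  have hφ'' : ∀ y, HasDerivAt (deriv φ) (deriv (deriv φ) y) y := fun y ↦
    (hd1.differentiable (by simp) y).hasDerivAt
  have hc2 : Continuous (deriv (deriv φ)) := hd2.continuous
  -- `L₂ ≥ 0`
  have hL₂ : 0 ≤ L₂ := by
    refine ge_of_tendsto h₂ ?_
    filter_upwards [hρ] with n hn
    exact mul_nonneg hn.le (integral_nonneg fun x ↦ sq_nonneg x)
  -- reduction to an `ε`-relaxed inequality
  suffices key : ∀ ε : ℝ, 0 < ε → 0 ≤ L₂ / 2 * deriv (deriv φ) η + L₁ * deriv φ η + ε * L₂ by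
    by_contra hK
    push Not at hK
    set K := L₂ / 2 * deriv (deriv φ) η + L₁ * deriv φ η with hKdef
    have hε : 0 < -K / (2 * (L₂ + 1)) := div_pos (by linarith) (by positivity)
    have h := key _ hε
    have hbound : -K / (2 * (L₂ + 1)) * L₂ ≤ -K / 2 := by
      rw [div_mul_eq_mul_div, div_le_iff₀ (by positivity : (0 : ℝ) < 2 * (L₂ + 1))]
      nlinarith
    linarith
  intro ε hε
  -- the continuity modulus of `φ''` at `η` and the touching neighbourhood
  obtain ⟨ρ₀, hρ₀, hmod⟩ := exists_modulus_of_continuous hc2 η hε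
  obtain ⟨ε₁, hε₁, hball⟩ := Metric.eventually_nhds_iff.1 hle
  have hsmall : ∀ᶠ n in atTop, r n < min (min δ ρ₀) ε₁ :=
    hr.eventually (Iio_mem_nhds (lt_min (lt_min hδ hρ₀) hε₁))
  -- the inequality along the sequence
  have hev : ∀ᶠ n in atTop, 0 ≤ deriv φ η * (ρ n * ∫ x, x ∂(ν n)) +
      deriv (deriv φ) η / 2 * (ρ n * ∫ x, x ^ 2 ∂(ν n)) + ε * (ρ n * ∫ x, x ^ 2 ∂(ν n)) := by
    filter_upwards [hsupp, hmvp, hρ, hsmall] with n hsuppn hmvpn hρn hrn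
    haveI := hprob n
    have hrδ : r n ≤ δ := (hrn.le.trans (min_le_left _ _)).trans (min_le_left _ _)
    have hrρ : r n ≤ ρ₀ := (hrn.le.trans (min_le_left _ _)).trans (min_le_right _ _)
    have hrε : r n < ε₁ := hrn.trans_le (min_le_right _ _)
    -- Taylor
    have hT := abs_integral_shift_sub_le (ν := ν n) (η := η) (ρ := ρ₀) (r := r n) hε.le
      (fun y _ ↦ hφ' y) (fun y _ ↦ hφ'' y) hmod hrρ hsuppn
    -- comparison `f η ≤ ∫ φ (η + x)`
    have hfi : Integrable (fun x ↦ f (η + x)) (ν n) :=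
      integrable_shift_of_continuousOn (ν := ν n) (η := η) (ρ := δ) (r := r n) hf hrδ hsuppn
    have hφi : Integrable (fun x ↦ φ (η + x)) (ν n) :=
      integrable_of_continuous_of_compl_null (hφ.continuous.comp (continuous_const_add η)) hsuppn
    have hcmp : ∫ x, f (η + x) ∂(ν n) ≤ ∫ x, φ (η + x) ∂(ν n) := by
      refine integral_mono_ae hfi hφi ?_
      filter_upwards [ae_mem_Icc_of_compl_null hsuppn] with x hx
      refine hball ?_
      rw [Real.dist_eq, add_sub_cancel_left]
      exact (abs_le.2 ⟨hx.1, hx.2⟩).trans_lt hrε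
    rw [hmvpn, ← hφη] at hcmp
    have hle := (le_abs_self _).trans hT
    have hm₂ : 0 ≤ ∫ x, x ^ 2 ∂(ν n) := integral_nonneg fun x ↦ sq_nonneg x
    have h0 : 0 ≤ deriv φ η * ∫ x, x ∂(ν n) + deriv (deriv φ) η / 2 * ∫ x, x ^ 2 ∂(ν n) +
        ε * ∫ x, x ^ 2 ∂(ν n) := by linarith
    have := mul_nonneg hρn.le h0
    nlinarith [this]
  -- pass to the limit
  have hlim : Tendsto (fun n ↦ deriv φ η * (ρ n * ∫ x, x ∂(ν n)) +
      deriv (deriv φ) η / 2 * (ρ n * ∫ x, x ^ 2 ∂(ν n)) + ε * (ρ n * ∫ x, x ^ 2 ∂(ν n))) atTop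
      (𝓝 (deriv φ η * L₁ + deriv (deriv φ) η / 2 * L₂ + ε * L₂)) :=
    ((h₁.const_mul _).add (h₂.const_mul _)).add (h₂.const_mul _)
  have := ge_of_tendsto hlim hev
  linarith

/-- **Touching from below.**  See the module docstring. [folklore] -/
theorem touchingBelow_of_mvp {f φ : ℝ → ℝ} {η δ : ℝ} (hδ : 0 < δ)
    (hf : ContinuousOn f (Icc (η - δ) (η + δ))) (hφ : ContDiff ℝ ∞ φ)
    (hφη : φ η = f η) (hle : ∀ᶠ y in 𝓝 η, φ y ≤ f y)
    {ν : ℕ → Measure ℝ} (hprob : ∀ n, IsProbabilityMeasure (ν n))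
    {r ρ : ℕ → ℝ} {L₁ L₂ : ℝ}
    (hr : Tendsto r atTop (𝓝 0)) (hsupp : ∀ᶠ n in atTop, (ν n) (Icc (-(r n)) (r n))ᶜ = 0)
    (hmvp : ∀ᶠ n in atTop, ∫ x, f (η + x) ∂(ν n) = f η)
    (hρ : ∀ᶠ n in atTop, 0 < ρ n)
    (h₁ : Tendsto (fun n ↦ ρ n * ∫ x, x ∂(ν n)) atTop (𝓝 L₁))
    (h₂ : Tendsto (fun n ↦ ρ n * ∫ x, x ^ 2 ∂(ν n)) atTop (𝓝 L₂)) :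
    L₂ / 2 * deriv (deriv φ) η + L₁ * deriv φ η ≤ 0 := by
  have hmvp' : ∀ᶠ n in atTop, ∫ x, (fun y ↦ -f y) (η + x) ∂(ν n) = (fun y ↦ -f y) η := by
    filter_upwards [hmvp] with n hn
    simp only [integral_neg, hn]
  have h := touchingAbove_of_mvp (f := fun y ↦ -f y) (φ := fun y ↦ -φ y) hδ hf.neg hφ.neg
    (by simp [hφη]) (hle.mono fun y hy ↦ neg_le_neg hy) hprob hr hsupp hmvp' hρ h₁ h₂
  have hd1 : deriv (fun y ↦ -φ y) = fun y ↦ -deriv φ y := funext fun y ↦ deriv.neg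
  have hd2 : deriv (fun y ↦ -deriv φ y) η = -deriv (deriv φ) η := deriv.neg
  rw [hd1, hd2] at h
  simp only at h
  linarith

end KernelODE

/-- **Registered form** (glue sub-goal `kernelODE_touchingAbove_of_mvp` of stmt-CriticalPhenomena-0746):
the viscosity inequality at a point touched from above, from asymptotic mean-value identities.
[folklore] -/
theorem kernelODE_touchingAbove_of_mvp : ∀ {f φ : ℝ → ℝ} {η δ : ℝ}, 0 < δ → ContinuousOn f (Set.Icc (η - δ) (η + δ)) → ContDiff ℝ ((⊤ : ℕ∞) : WithTop ℕ∞) φ → φ η = f η → (∀ᶠ y in nhds η, f y ≤ φ y) → ∀ {ν : ℕ → MeasureTheory.Measure ℝ}, (∀ n, MeasureTheory.IsProbabilityMeasure (ν n)) → ∀ {r ρ : ℕ → ℝ} {L₁ L₂ : ℝ}, Filter.Tendsto r Filter.atTop (nhds 0) → (∀ᶠ n in Filter.atTop, (ν n) (Set.Icc (-(r n)) (r n))ᶜ = 0) → (∀ᶠ n in Filter.atTop, ∫ x, f (η + x) ∂(ν n) = f η) → (∀ᶠ n in Filter.atTop, 0 < ρ n) → Filter.Tendsto (fun n ↦ ρ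 n * ∫ x, x ∂(ν n)) Filter.atTop (nhds L₁) → Filter.Tendsto (fun n ↦ ρ n * ∫ x, x ^ 2 ∂(ν n)) Filter.atTop (nhds L₂) → 0 ≤ L₂ / 2 * deriv (deriv φ) η + L₁ * deriv φ η :=
  fun hδ hf hφ hφη hle _ hprob _ _ _ _ hr hsupp hmvp hρ h₁ h₂ ↦
    KernelODE.touchingAbove_of_mvp hδ hf hφ hφη hle hprob hr hsupp hmvp hρ h₁ h₂

end Summit.CriticalPhenomena.CardyFormulaZ2.Cruxes.CardyRigidity.CrossingMartingale

end
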